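import Literature.Geometry.Kaehler.ComplexTorusChainPeriodicStokes
import Literature.Geometry.Kaehler.ComplexTorusAnalyticCycleClass
import Literature.Geometry.Kaehler.ComplexTorusIntegralFormsBasis
import Literature.Geometry.Kaehler.ComplexTorusRationalFormsBasis
import Literature.Geometry.GeometricMeasureTheory.CurrentsConstancy
import Literature.Geometry.GeometricMeasureTheory.PushforwardRectifiable
import Literature.Geometry.GeometricMeasureTheory.CurrentsPushforwardMass
import Mathlib.MeasureTheory.Integral.Pi
import Mathlib.MeasureTheory.Measure.Haar.InnerProductSpace
import HarnessLib

/-!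
# Integrality of the periods of a periodic holomorphic chain; the class of an analytic cycle of a
# complex torus is an integral Hodge class

Layer `Literature/Geometry/Kaehler`; lane `lit-hodgefound`, Layer A4, row A4-18 (b) stage (ii)
(`run/shared/lean/pub/lit-hodgefound/SKELETON.md` §P Q58 / Q182, node N5 of
`lit-hodgefound-p07/Q58-STAGING.md`, Route B, steps B2–B3).

Let `X = E/Λ`, `Λ = Φ(ℤ^ι)`, be a complex torus and `T` a holomorphic `(q+1)`-chain on `E` with
`Λ`-periodic carrier and density (the lift `π^* Z` of an analytic cycle `Z` of `X`). We prove that the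
period functional `torusPeriod Φ T : H^{2q+2}(X, ℂ) = Alt^{2q+2}_ℝ(E; ℂ) → ℂ`, `ω ↦ ∫_{Z} ω`
(`ComplexTorusChainPeriods.lean`), takes INTEGER values on `H^{2q+2}(X, ℤ) = integralForms Φ (2q+2)`:

* `HolomorphicChain.exists_int_torusPeriod_eq_of_periodic` — `∫_Z η ∈ ℤ` for every `η ∈ H^{2q+2}(X, ℤ)`;
* `ComplexTorus.exists_int_analyticCyclePeriod_eq` — the same for the chain `[π⁻¹ Z]` of a closed
  analytic subset `Z ⊆ X` of pure dimension `q + 1`;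
* **`ComplexTorus.analyticCycleClass_mem_integralHodgeClasses_of_pos`** — hence the class
  `[Z] ∈ H^{2p}(X, ℤ) ∩ H^{p,p} = integralHodgeClasses Φ p` UNCONDITIONALLY (the hypothesis `hint` of
  `analyticCycleClass_mem_integralHodgeClasses` discharged): Voisin (2002), §11.1.2–11.1.3,
  Prop. 11.20 with Thm. 11.21, for subvarieties of positive dimension of a complex torus.

## The proof (Federer's constancy theorem in place of singular homology)

`H^{2q+2}(X, ℤ)` is generated by the lattice monomials `dx_w = dx_{w₀} ∧ ⋯ ∧ dx_{w_{2q+1}}`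
(`integralForms_eq_closure_latMonomial`), so it suffices to show `∫_Z dx_w ∈ ℤ` for an injective word
`w` (otherwise `dx_w = 0`). Let `p = p_w : E → ℝ^{2q+2}`, `x ↦ (x_{w j})_j`, be the coordinate
projection, so that `dx_w = p^* dy` (`realLatMonomial`, `latMonomial_eq_ofReal_realLatMonomial`), and
`K = ι ∖ w` the complementary coordinates with slab fundamental domain `D_K = {x_k ∈ [0,1), k ∈ K}` of
`Λ_K` (`ComplexTorusChainPeriodicStokes.lean`).

1. The current `T_B = [reg|T| ∩ B]`, `B = D_K ∩ p⁻¹ B(0, R')`, is rectifiable with compact support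
   (Lelong), and its push-forward `S = p_# T_B` is a rectifiable `(2q+2)`-current of finite mass on
   `ℝ^{2q+2}` (tree: `Current.IsRectifiable.pushforward_top`, Federer 4.1.30).
2. `∂S = 0` on `B(0, R)`, `R < R'`: `∂S(φ) = ∫_{D_K} θ_T ⟨d(p^*φ), ξ_T⟩ d𝓗 = 0` by STOKES OVER THE SLAB
   (`setIntegral_slab_density_mul_extDeriv_apply_eq_zero`, B1), `p^*φ` being `Λ_K`-periodic and
   bounded in the directions `w`.
3. CONSTANCY (tree: `Current.IsRectifiable.exists_int_restrictSet_eq_face`, Federer 4.1.31 with the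
   integrality of densities 4.1.28): `S ⌞ B(0,R) = a [B(0,R)]` for an INTEGER `a`.
4. Test both sides on `h dy`, `h(y) = Π_j ψ(y_j)` with `ψ` the smooth partition-of-unity bump of B1
   (`Σ_m ψ(t + m) = 1`, `∫ ψ = 1`): the right side is `a ∫ h = a`; the left side is
   `∫_{D_K} θ_T h(p x) dx_w(ξ_T) d𝓗`, and UNFOLDING along `Λ_w` (`integral_eq_sum_setIntegral_slab`)
   with `Σ_m h(p(x + Φm)) = 1` turns it into `∫_{D_K ∩ D_w} θ_T dx_w(ξ_T) = ∫_{Φ[0,1)^ι} θ_T dx_w(ξ_T)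
   = torusPeriod Φ T dx_w`. Hence `∫_Z dx_w = a ∈ ℤ`.

This replaces the comparison with the singular fundamental class (Borel–Haefliger) in Voisin's
argument by Federer's constancy theorem; every analytic input (Lelong's finiteness, Harvey's
`d[T] = 0`, rectifiability of push-forwards, constancy) is a theorem of the tree.

Definitions with bodies (`bumpProd`, `bumpProdTest`, `ComplexTorus.wordProj`,
`ComplexTorus.realLatMonomial`, `ComplexTorus.wordCompl`, `ComplexTorus.projWindow`,
`HolomorphicChain.windowCurrent`, `HolomorphicChain.projCurrent`) and theorems; no named fact. The case of
dimension `0` (finite sets of points, `H^{2g}`) is not treated here.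

## References

* [VoisinHodgeI2002] C. Voisin, *Hodge Theory and Complex Algebraic Geometry I*, CUP (2002), §11.1.2
  Cor. 11.15, Thm. 11.21, §11.1.3 Prop. 11.20.
* [Federer1969] H. Federer, *Geometric Measure Theory*, Springer (1969), 4.1.7, 4.1.28, 4.1.30,
  4.1.31.
* [Lange2023AbelianVarietiesComplex] H. Lange, *Abelian Varieties over the Complex Numbers*, Springer
  (2023), §1.1.1, §1.1.3 Exercise 1.1.6 (7), §1.1.4 Prop. 1.1.20, §6.2.1 Lemma 6.2.7.
* [Harvey1977] R. Harvey, *Holomorphic chains and their boundaries*, PSPUM XXX.1 (1977), Lemma 1.3,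
  Thm. 1.8.
* [Chirka1989] E. M. Chirka, *Complex Analytic Sets*, Kluwer (1989), §14.1.
-/

noncomputable section

open scoped Manifold ENNReal NNReal Pointwise Topology ContDiff Distributions
open MeasureTheory TopologicalSpace Set Function Module Metric Filter
open Literature.Geometry.GeometricMeasureTheory Literature.LinearAlgebra.Alternating

namespace Literature.Geometry.Kaehler

universe u

-- Nested operator-norm instances on (duals of) `V [⋀^Fin m]→L[ℝ] ℝ` need one more level of pending
-- instance problems, as in the tree's `Currents*.lean` files.
set_option maxSynthPendingDepth 2

/-! ### The bump `ψ` has integral one; the product bump on `ℝ^N` -/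

section Bump

/-- `∫ ψ = 1`: `ψ(t) = S(t) − S(t − 1)` with `S = 1` on `[1, ∞)` and `S = 0` on `(−∞, 0]`, so
`∫ ψ = ∫_0^2 S − ∫_{-1}^1 S = ∫_1^2 1 − ∫_{-1}^0 0 = 1`. [cite: Federer1969, 4.1.7] -/
theorem integral_unitPartition : ∫ t, unitPartition t = 1 := by
  have hS : Continuous Real.smoothTransition := Real.smoothTransition.continuous
  have hSi : ∀ a b : ℝ, IntervalIntegrable Real.smoothTransition volume a b :=
    fun a b ↦ hS.intervalIntegrable a b
  have hsupp : support unitPartition ⊆ Ioc (0 : ℝ) 2 := fun t ht ↦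
    Ioo_subset_Ioc_self (mem_Ioo_of_unitPartition_ne_zero ht)
  rw [← intervalIntegral.integral_eq_integral_of_support_subset hsupp]
  have h1 : ∫ t in (0 : ℝ)..2, unitPartition t =
      (∫ t in (0 : ℝ)..2, Real.smoothTransition t) -
        ∫ t in (0 : ℝ)..2, Real.smoothTransition (t - 1) := by
    simp only [unitPartition]
    exact intervalIntegral.integral_sub (hSi 0 2)
      ((hS.comp (continuous_id.sub continuous_const)).intervalIntegrable 0 2)
  have h4 : ∫ t in (0 : ℝ)..2, Real.smoothTransition (t - 1) =
      ∫ t in (-1 : ℝ)..1, Real.smoothTransition t := by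
    rw [intervalIntegral.integral_comp_sub_right (fun t ↦ Real.smoothTransition t) (1 : ℝ)]
    norm_num
  have h2 : ∫ t in (1 : ℝ)..2, Real.smoothTransition t = 1 := by
    rw [intervalIntegral.integral_congr (g := fun _ ↦ (1 : ℝ)) fun t ht ↦ ?_]
    · norm_num
    · rw [uIcc_of_le (by norm_num : (1 : ℝ) ≤ 2)] at ht
      exact Real.smoothTransition.one_of_one_le ht.1
  have h3 : ∫ t in (-1 : ℝ)..0, Real.smoothTransition t = 0 := by
    rw [intervalIntegral.integral_congr (g := fun _ ↦ (0 : ℝ)) fun t ht ↦ ?_]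
    · simp
    · rw [uIcc_of_le (by norm_num : (-1 : ℝ) ≤ 0)] at ht
      exact Real.smoothTransition.zero_of_nonpos ht.2
  rw [h1, h4, ← intervalIntegral.integral_add_adjacent_intervals (hSi 0 1) (hSi 1 2),
    ← intervalIntegral.integral_add_adjacent_intervals (hSi (-1) 0) (hSi 0 1), h2, h3]
  ring

variable (N : ℕ)

/-- **The product bump `h(y) = Π_j ψ(y_j)` on `ℝ^N`.** [cite: Federer1969, 4.1.7] -/
def bumpProd (y : EuclideanSpace ℝ (Fin N)) : ℝ := ∏ j, unitPartition (y j)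

/-- `h` is smooth. [cite: Federer1969, 4.1.7] -/
theorem contDiff_bumpProd {n : ℕ∞} : ContDiff ℝ n (bumpProd N) := by
  refine contDiff_prod fun j _ ↦ ?_
  have hj : ContDiff ℝ n fun y : EuclideanSpace ℝ (Fin N) ↦ y j :=
    (EuclideanSpace.proj (𝕜 := ℝ) j).contDiff
  exact contDiff_unitPartition.comp hj

/-- `h(y) ≠ 0` forces `0 < y_j < 2`. [cite: Federer1969, 4.1.7] -/
theorem mem_Ioo_of_bumpProd_ne_zero {y : EuclideanSpace ℝ (Fin N)} (hy : bumpProd N y ≠ 0) (j : Fin N) :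
    y j ∈ Ioo (0 : ℝ) 2 :=
  mem_Ioo_of_unitPartition_ne_zero fun h ↦ hy (Finset.prod_eq_zero (Finset.mem_univ j) h)

/-- A point with coordinates in `[0, 2]` has norm `≤ 2N`. [cite: Federer1969, 4.1.7] -/
theorem norm_le_of_forall_mem_Icc {y : EuclideanSpace ℝ (Fin N)} (hy : ∀ j, y j ∈ Icc (0 : ℝ) 2) :
    ‖y‖ ≤ 2 * N := by
  have hN : (N : ℝ) ≤ (N : ℝ) ^ 2 := by
    rcases Nat.eq_zero_or_pos N with h | h
    · simp [h]
    · have h1 : (1 : ℝ) ≤ N := by exact_mod_cast h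
      nlinarith
  have hsq : ‖y‖ ^ 2 ≤ (2 * N) ^ 2 := by
    rw [PiLp.norm_sq_eq_of_L2]
    calc ∑ j, ‖y j‖ ^ 2 ≤ ∑ _j : Fin N, (2 : ℝ) ^ 2 := Finset.sum_le_sum fun j _ ↦ by
            rw [Real.norm_eq_abs, sq_abs]
            have h := hy j
            nlinarith [h.1, h.2]
      _ = 4 * N := by simp; ring
      _ ≤ (2 * N) ^ 2 := by nlinarith
  exact (pow_le_pow_iff_left₀ (norm_nonneg _) (by positivity) two_ne_zero).1 hsq

/-- `tsupport h ⊆ {y | y_j ∈ [0, 2] ∀ j} ⊆ B̄(0, 2N)`. [cite: Federer1969, 4.1.7] -/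
theorem tsupport_bumpProd_subset : tsupport (bumpProd N) ⊆ closedBall (0 : EuclideanSpace ℝ (Fin N)) (2 * N) := by
  have hcl : IsClosed {y : EuclideanSpace ℝ (Fin N) | ∀ j, y j ∈ Icc (0 : ℝ) 2} := by
    have h : {y : EuclideanSpace ℝ (Fin N) | ∀ j, y j ∈ Icc (0 : ℝ) 2} = ⋂ j, (fun y ↦ y j) ⁻¹' Icc 0 2 := by
      ext y; simp
    rw [h]
    exact isClosed_iInter fun j ↦ isClosed_Icc.preimage (EuclideanSpace.proj j).continuous
  refine (closure_minimal (fun y hy j ↦ Ioo_subset_Icc_self (mem_Ioo_of_bumpProd_ne_zero N hy j)) hcl).trans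
    fun y hy ↦ ?_
  rw [mem_closedBall, dist_zero_right]
  exact norm_le_of_forall_mem_Icc N hy

/-- `h` has compact support. [cite: Federer1969, 4.1.7] -/
theorem hasCompactSupport_bumpProd : HasCompactSupport (bumpProd N) :=
  HasCompactSupport.of_support_subset_isCompact (isCompact_closedBall 0 (2 * N))
    ((subset_tsupport _).trans (tsupport_bumpProd_subset N))

/-- `support h ⊆ B(0, 2N + 1)`. [cite: Federer1969, 4.1.7] -/
theorem support_bumpProd_subset_ball : support (bumpProd N) ⊆ ball (0 : EuclideanSpace ℝ (Fin N)) (2 * N + 1) :=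
  ((subset_tsupport _).trans (tsupport_bumpProd_subset N)).trans
    (closedBall_subset_ball (by linarith))

/-- **`∫ h dy = 1`.** [cite: Federer1969, 4.1.7] -/
theorem integral_bumpProd : ∫ y, bumpProd N y = 1 := by
  have h := (EuclideanSpace.volume_preserving_symm_measurableEquiv_toLp (Fin N)).integral_comp'
    (g := fun z : Fin N → ℝ ↦ ∏ j, unitPartition (z j))
  simp only [MeasurableEquiv.coe_toLp_symm] at h
  change ∫ y : EuclideanSpace ℝ (Fin N), ∏ j, unitPartition (y j) = 1
  rw [h, integral_fintype_prod_volume_eq_prod (fun _ : Fin N ↦ unitPartition)]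
  exact Finset.prod_eq_one fun _ _ ↦ integral_unitPartition

/-- The product bump as a test function on `ℝ^N`. [cite: Federer1969, 4.1.7] -/
def bumpProdTest : 𝓓((⊤ : Opens (EuclideanSpace ℝ (Fin N))), ℝ) :=
  ⟨bumpProd N, contDiff_bumpProd N, hasCompactSupport_bumpProd N, by simp⟩

/-- Unfolding `bumpProdTest`. [cite: Federer1969, 4.1.7] -/
@[simp] theorem bumpProdTest_apply (y : EuclideanSpace ℝ (Fin N)) : bumpProdTest N y = bumpProd N y := rfl

end Bump

/-! ### The coordinate projection `p_w : E → ℝ^N` of a word and the real lattice monomial `dx_w = p_w^* dy` -/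

namespace ComplexTorus

section WordProj

variable {ι : Type*} {E : Type u} [NormedAddCommGroup E] [NormedSpace ℂ E] (Φ : (ι → ℝ) ≃L[ℝ] E)
  {N : ℕ}

/-- **The coordinate projection of a word** `w : Fin N → ι`: `p_w(x) = (x_{w 0}, …, x_{w (N-1)}) ∈ ℝ^N`
(lattice coordinates `x = Φ⁻¹`). [cite: Lange2023AbelianVarietiesComplex, §1.1.4 Prop. 1.1.20] -/
def wordProj (w : Fin N → ι) : E →L[ℝ] EuclideanSpace ℝ (Fin N) :=
  ((EuclideanSpace.equiv (Fin N) ℝ).symm : (Fin N → ℝ) →L[ℝ] EuclideanSpace ℝ (Fin N)).comp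
    (ContinuousLinearMap.pi fun j ↦ coord Φ (w j))

/-- `p_w(x)_j = x_{w j}`. [cite: Lange2023AbelianVarietiesComplex, §1.1.4 Prop. 1.1.20] -/
@[simp] theorem wordProj_apply (w : Fin N → ι) (x : E) (j : Fin N) : wordProj Φ w x j = Φ.symm x (w j) := rfl

/-- `|x_{w j}| ≤ ‖p_w(x)‖`. [cite: Lange2023AbelianVarietiesComplex, §1.1.4 Prop. 1.1.20] -/
theorem abs_symm_apply_le_norm_wordProj (w : Fin N → ι) (x : E) (j : Fin N) :
    |Φ.symm x (w j)| ≤ ‖wordProj Φ w x‖ := by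
  rw [← wordProj_apply Φ w x j, ← Real.norm_eq_abs]
  exact PiLp.norm_apply_le (wordProj Φ w x) j

/-- `p_w` is smooth. [cite: Lange2023AbelianVarietiesComplex, §1.1.4 Prop. 1.1.20] -/
theorem contDiff_wordProj (w : Fin N → ι) : ContDiff ℝ ∞ (wordProj Φ w) := (wordProj Φ w).contDiff

/-- `p_w` kills the lattice vectors supported off `w`: `p_w(Φm + x) = p_w(x)` for `m ∈ ℤ^K`,
`K ∩ w = ∅`. [cite: Lange2023AbelianVarietiesComplex, §1.1.1] -/
theorem wordProj_latticeVecOn_add [DecidableEq ι] (K : Finset ι) (w : Fin N → ι) (hw : ∀ j, w j ∉ K)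
    (m : K → ℤ) (x : E) : wordProj Φ w (latticeVecOn Φ K m + x) = wordProj Φ w x := by
  ext j
  rw [wordProj_apply, wordProj_apply, map_add, Pi.add_apply, symm_latticeVecOn_apply_of_notMem Φ K m (hw j),
    zero_add]

/-- `p_w(Φm + x) = p_w(x) + (m_{w j})_j` for a full lattice vector. [cite: Lange2023AbelianVarietiesComplex, §1.1.1] -/
theorem wordProj_latticeVec_add_apply (w : Fin N → ι) (m : ι → ℤ) (x : E) (j : Fin N) :
    wordProj Φ w (latticeVec Φ m + x) j = (m (w j) : ℝ) + Φ.symm x (w j) := by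
  rw [wordProj_apply, map_add, Pi.add_apply, symm_latticeVec_apply]

/-- **The real lattice monomial `dx_w = p_w^* dy ∈ Alt^N_ℝ(E; ℝ)`**: the pull-back along `p_w` of the
volume covector `dy = e^*` of the standard orthonormal frame of `ℝ^N`. [cite: Lange2023AbelianVarietiesComplex, §1.1.4 Prop. 1.1.20] -/
def realLatMonomial (w : Fin N → ι) : E [⋀^Fin N]→L[ℝ] ℝ :=
  (frameCovector ⇑(EuclideanSpace.basisFun (Fin N) ℝ)).compContinuousLinearMap (wordProj Φ w)

/-- `dx_w(v) = det (x_{w i}(v_j))`. [cite: Lange2023AbelianVarietiesComplex, §1.1.4 Prop. 1.1.20] -/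
theorem realLatMonomial_apply (w : Fin N → ι) (v : Fin N → E) :
    realLatMonomial Φ w v = (Matrix.of fun i j ↦ Φ.symm (v j) (w i)).det := by
  rw [realLatMonomial, ContinuousAlternatingMap.compContinuousLinearMap_apply, frameCovector_apply,
    ← Matrix.det_transpose]
  congr 1
  ext i j
  rw [Matrix.transpose_apply, Matrix.of_apply, Matrix.of_apply, comp_apply, EuclideanSpace.basisFun_inner,
    wordProj_apply]

/-- `e^*(p_w ∘ v) = dx_w(v)`. [cite: Lange2023AbelianVarietiesComplex, §1.1.4 Prop. 1.1.20] -/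
theorem frameCovector_basisFun_wordProj (w : Fin N → ι) (v : Fin N → E) :
    frameCovector ⇑(EuclideanSpace.basisFun (Fin N) ℝ) (fun i ↦ wordProj Φ w (v i)) = realLatMonomial Φ w v := rfl

/-- **`dx_w ∈ Alt^N_ℝ(E; ℂ)` is the complexification of the real monomial**: `latMonomial Φ N w =
dx_w ⊗ 1`, both being `v ↦ det (x_{w i}(v_j))`. [cite: Lange2023AbelianVarietiesComplex, §1.1.4 Prop. 1.1.20] -/
theorem latMonomial_eq_ofReal_realLatMonomial (w : Fin N → ι) :
    latMonomial Φ N w = Complex.ofRealCLM.compContinuousAlternatingMap (realLatMonomial Φ w) := by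
  ext v
  rw [ContinuousLinearMap.compContinuousAlternatingMap_coe, comp_apply, Complex.ofRealCLM_apply,
    realLatMonomial_apply, latMonomial_eq, wedgeWord_apply]
  have hM : pairingMatrix (fun a ↦ (coord Φ a).smulRight (1 : ℂ)) w v =
      (Matrix.of fun i j ↦ Φ.symm (v j) (w i)).map (algebraMap ℝ ℂ) := by
    ext i j
    rw [pairingMatrix_apply, ContinuousLinearMap.smulRight_apply, coord_apply, Matrix.map_apply,
      Matrix.of_apply, Complex.real_smul, mul_one]
    rfl
  rw [hM, ← RingHom.mapMatrix_apply, ← RingHom.map_det]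
  change (algebraMap ℝ ℂ) _ • (1 : ℂ) = _
  rw [smul_eq_mul, mul_one]
  rfl

/-- `latMonomial Φ N w (v) = dx_w(v)` as a real number. [cite: Lange2023AbelianVarietiesComplex, §1.1.4 Prop. 1.1.20] -/
theorem latMonomial_apply_eq_ofReal (w : Fin N → ι) (v : Fin N → E) :
    latMonomial Φ N w v = ((realLatMonomial Φ w v : ℝ) : ℂ) := by
  rw [latMonomial_eq_ofReal_realLatMonomial]; rfl

/-- A word with a repeated letter gives the zero monomial. [cite: Lange2023AbelianVarietiesComplex, §1.1.4 Prop. 1.1.20] -/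
theorem latMonomial_eq_zero_of_not_injective (w : Fin N → ι) (hw : ¬ Injective w) : latMonomial Φ N w = 0 := by
  rw [latMonomial_eq]
  exact wedgeWord_eq_zero_of_not_injective _ _ w hw

variable [DecidableEq ι]

/-- The fundamental weight of the coordinate set `w(Fin N)` is the product bump of the projection:
`w_{im w}(x) = h(p_w x)` for injective `w`. [cite: Federer1969, 4.1.7] -/
theorem weight_image_eq_bumpProd_wordProj (w : Fin N → ι) (hw : Injective w) (x : E) :
    weight Φ (Finset.univ.image w) x = bumpProd N (wordProj Φ w x) := by
  rw [weight, Finset.prod_image fun a _ b _ h ↦ hw h, bumpProd]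
  rfl

end WordProj

/-! ### The complementary coordinates of a word and the projection window -/

section Window

variable {ι : Type*} [Fintype ι] [DecidableEq ι] {E : Type u} [NormedAddCommGroup E] [InnerProductSpace ℂ E]
  (Φ : (ι → ℝ) ≃L[ℝ] E) {N : ℕ}

/-- The coordinates NOT hit by the word `w`. [cite: Lange2023AbelianVarietiesComplex, §1.1.1] -/
def wordCompl (w : Fin N → ι) : Finset ι := (Finset.univ.image w)ᶜ

/-- The letters of `w` lie outside `wordCompl w`. [cite: Lange2023AbelianVarietiesComplex, §1.1.1] -/
theorem apply_notMem_wordCompl (w : Fin N → ι) (j : Fin N) : w j ∉ wordCompl w := by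
  rw [wordCompl, Finset.mem_compl, not_not]
  exact Finset.mem_image_of_mem w (Finset.mem_univ j)

/-- A coordinate outside `wordCompl w` is a letter of `w`. [cite: Lange2023AbelianVarietiesComplex, §1.1.1] -/
theorem exists_apply_eq_of_notMem_wordCompl (w : Fin N → ι) {i : ι} (hi : i ∉ wordCompl w) : ∃ j, w j = i := by
  rw [wordCompl, Finset.mem_compl, not_not, Finset.mem_image] at hi
  obtain ⟨j, -, hj⟩ := hi
  exact ⟨j, hj⟩

/-- Outside `wordCompl w`, coordinates are bounded by `‖p_w x‖`. [cite: Lange2023AbelianVarietiesComplex, §1.1.1] -/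
theorem abs_symm_apply_le_norm_wordProj_of_notMem (w : Fin N → ι) (x : E) {i : ι} (hi : i ∉ wordCompl w) :
    |Φ.symm x i| ≤ ‖wordProj Φ w x‖ := by
  obtain ⟨j, rfl⟩ := exists_apply_eq_of_notMem_wordCompl w hi
  exact abs_symm_apply_le_norm_wordProj Φ w x j

/-- The slab of `wordCompl w` meets the slab of the letters of `w` in the period box:
`{x_k ∈ [0,1), k ∉ w} ∩ {x_{w j} ∈ [0,1) ∀ j} = Φ [0,1)^ι`. [cite: Lange2023AbelianVarietiesComplex, §1.1.1] -/
theorem slab_image_inter_slab_wordCompl (w : Fin N → ι) :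
    slab Φ (Finset.univ.image w) 0 ∩ slab Φ (wordCompl w) 0 = periodBox Φ 0 := by
  ext x
  rw [mem_inter_iff, mem_slab_iff, mem_slab_iff, mem_periodBox_iff]
  constructor
  · rintro ⟨h1, h2⟩ i
    by_cases hi : i ∈ wordCompl w
    · exact h2 i hi
    · obtain ⟨j, rfl⟩ := exists_apply_eq_of_notMem_wordCompl w hi
      exact h1 _ (Finset.mem_image_of_mem w (Finset.mem_univ j))
  · intro h
    exact ⟨fun k _ ↦ h k, fun k _ ↦ h k⟩

/-- **The projection window** `B = {x_k ∈ [0,1), k ∉ w} ∩ p_w⁻¹ B(0, R)`: one period of the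
complementary lattice `Λ_{ι ∖ w}` over the ball `B(0, R) ⊆ ℝ^N`. [cite: Federer1969, 4.1.7] -/
def projWindow (w : Fin N → ι) (R : ℝ) : Set E := slab Φ (wordCompl w) 0 ∩ wordProj Φ w ⁻¹' ball 0 R

/-- The projection window is a Borel set. [cite: Federer1969, 4.1.7] -/
theorem measurableSet_projWindow [MeasurableSpace E] [BorelSpace E] (w : Fin N → ι) (R : ℝ) :
    MeasurableSet (projWindow Φ w R) :=
  (measurableSet_slab Φ _ 0).inter (isOpen_ball.preimage (wordProj Φ w).continuous).measurableSet

/-- The projection window lies in the compact coordinate box `{x_k ∈ [-1,3] (k ∉ w), |x_i| ≤ R (i ∈ w)}`.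
[cite: Federer1969, 4.1.7] -/
theorem projWindow_subset_coordBox (w : Fin N → ι) (R : ℝ) :
    projWindow Φ w R ⊆ HolomorphicChain.coordBox Φ (wordCompl w) R := by
  rintro x ⟨hx1, hx2⟩
  refine ⟨fun k hk ↦ ?_, fun i hi ↦ ?_⟩
  · have h := hx1 k hk
    simp only [Pi.zero_apply, zero_add, mem_Ico] at h
    exact ⟨by linarith [h.1], by linarith [h.2]⟩
  · rw [mem_preimage, mem_ball, dist_zero_right] at hx2
    exact (abs_symm_apply_le_norm_wordProj_of_notMem Φ w x hi).trans hx2.le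

/-- The closure of the projection window is compact. [cite: Federer1969, 4.1.7] -/
theorem isCompact_closure_projWindow (w : Fin N → ι) (R : ℝ) : IsCompact (closure (projWindow Φ w R)) :=
  (HolomorphicChain.isCompact_coordBox Φ _ R).of_isClosed_subset isClosed_closure
    (closure_minimal (projWindow_subset_coordBox Φ w R) (HolomorphicChain.isCompact_coordBox Φ _ R).isClosed)

/-- **The slab of the complementary coordinates is invariant under `Λ_w`**, the lattice vectors supported
in the letters of `w`: `Φm + x ∈ slab (wordCompl w) ↔ x ∈ slab (wordCompl w)` for `m ∈ ℤ^{im w}`.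
[cite: Lange2023AbelianVarietiesComplex, §1.1.1] -/
theorem latticeVecOn_image_add_mem_slab_wordCompl_iff (w : Fin N → ι) (m : Finset.univ.image w → ℤ)
    (x : E) : latticeVecOn Φ (Finset.univ.image w) m + x ∈ slab Φ (wordCompl w) 0 ↔ x ∈ slab Φ (wordCompl w) 0 := by
  have hk : ∀ k ∈ wordCompl w, k ∉ Finset.univ.image w := fun k hk ↦ by
    rwa [wordCompl, Finset.mem_compl] at hk
  simp only [mem_slab_iff, map_add, Pi.add_apply]
  constructor
  · intro h k hkK
    have := h k hkK
    rwa [symm_latticeVecOn_apply_of_notMem Φ _ m (hk k hkK), zero_add] at this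
  · intro h k hkK
    rw [symm_latticeVecOn_apply_of_notMem Φ _ m (hk k hkK), zero_add]
    exact h k hkK

end Window

end ComplexTorus

/-! ### The current of the part of a chain inside a window, and its push-forward -/

namespace HolomorphicChain

section Window

variable {E : Type u} [NormedAddCommGroup E] [InnerProductSpace ℂ E] [FiniteDimensional ℂ E]
  [MeasurableSpace E] [BorelSpace E] {p : ℕ}

/-- **The current `[reg|T| ∩ B, θ_T, ξ_T]` of the part of a holomorphic chain inside a Borel window
`B`** (`= [T] ⌞ B`, Federer 4.1.7). [cite: Federer1969, 4.1.7] -/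
def windowCurrent (T : HolomorphicChain 𝓘(ℂ, E) (⊤ : Opens E) p) (B : Set E) : Current (⊤ : Opens E) (2 * p) :=
  currentOfIntegration (T.carrier ∩ B) T.density T.orientationFrame

/-- The cut data are admissible. [cite: Federer1969, 4.1.28] -/
theorem isRectifiableData_inter (T : HolomorphicChain 𝓘(ℂ, E) (⊤ : Opens E) p) {B : Set E}
    (hB : MeasurableSet B) :
    letI : InnerProductSpace ℝ E := InnerProductSpace.complexToReal
    IsRectifiableData (⊤ : Opens E) (2 * p) (T.carrier ∩ B) T.density T.orientationFrame := by
  letI : InnerProductSpace ℝ E := InnerProductSpace.complexToReal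
  exact T.isRectifiableData.inter hB

/-- **`[T]⌞B (φ) = ∫_B θ_T φ(ξ_T) d(𝓗^{2p} ⌞ reg|T|)`.** [cite: Federer1969, 4.1.7] -/
theorem windowCurrent_apply (T : HolomorphicChain 𝓘(ℂ, E) (⊤ : Opens E) p) {B : Set E}
    (hB : MeasurableSet B) (φ : TestForm (⊤ : Opens E) (2 * p)) :
    T.windowCurrent B φ = ∫ x in B, (T.density x : ℝ) * φ x (T.orientationFrame x)
      ∂((μHE[2 * p] : Measure E).restrict T.carrier) := by
  letI : InnerProductSpace ℝ E := InnerProductSpace.complexToReal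
  rw [windowCurrent, currentOfIntegration_apply (T.isRectifiableData_inter hB).2.2.2.1,
    Measure.restrict_restrict hB, inter_comm]

omit [FiniteDimensional ℂ E] in
/-- `spt [T]⌞B ⊆ closure B`. [cite: Federer1969, 4.1.7] -/
theorem support_windowCurrent_subset (T : HolomorphicChain 𝓘(ℂ, E) (⊤ : Opens E) p) (B : Set E) :
    (T.windowCurrent B).support ⊆ closure B :=
  (support_currentOfIntegration_subset_closure _ _ _).trans (closure_mono inter_subset_right)

/-- **`[T]⌞B` is a rectifiable current** (compact support) for a relatively compact window.
[cite: Federer1969, 4.1.28] -/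
theorem isRectifiable_windowCurrent (T : HolomorphicChain 𝓘(ℂ, E) (⊤ : Opens E) p) {B : Set E}
    (hB : MeasurableSet B) (hBc : IsCompact (closure B)) :
    letI : InnerProductSpace ℝ E := InnerProductSpace.complexToReal
    (T.windowCurrent B).IsRectifiable := by
  letI : InnerProductSpace ℝ E := InnerProductSpace.complexToReal
  have hcl : IsClosed (T.windowCurrent B).support := by
    have h := (T.windowCurrent B).isOpen_sdiff_support
    rw [show (((⊤ : Opens E) : Set E)) = univ from rfl, ← compl_eq_univ_sdiff] at h
    exact isOpen_compl_iff.1 h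
  exact ⟨⟨_, _, _, T.isRectifiableData_inter hB, rfl⟩,
    hBc.of_isClosed_subset hcl (T.support_windowCurrent_subset B)⟩

/-- `[T]⌞B` is representable by integration (it has locally finite mass). [cite: Federer1969, 4.1.7] -/
theorem isRepresentable_windowCurrent (T : HolomorphicChain 𝓘(ℂ, E) (⊤ : Opens E) p) {B : Set E}
    (hB : MeasurableSet B) : (T.windowCurrent B).IsRepresentable := by
  letI : InnerProductSpace ℝ E := InnerProductSpace.complexToReal
  exact (T.isRectifiableData_inter hB).isRepresentable

end Window

end HolomorphicChain

/-! ### Calculus lemmas -/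

section Aux

variable {V : Type u} [NormedAddCommGroup V] [NormedSpace ℝ V]

/-- A form which vanishes near `x` has `dΨ(x) = 0`. [cite: Federer1969, 4.1.6] -/
theorem extDeriv_eq_zero_of_notMem_tsupport' {k : ℕ} {Ψ : V → V [⋀^Fin k]→L[ℝ] ℝ} {x : V}
    (hx : x ∉ tsupport Ψ) : extDeriv Ψ x = 0 := by
  have h : Ψ =ᶠ[𝓝 x] fun _ ↦ 0 := notMem_tsupport_iff_eventuallyEq.1 hx
  rw [h.extDeriv_eq, extDeriv, fderiv_const_apply]
  exact (ContinuousAlternatingMap.alternatizeUncurryFinCLM ℝ V ℝ).map_zero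

/-- A `G`-invariant measure restricted to a measurable `G`-invariant set is `G`-invariant. [cite: Federer1969, 4.1.7] -/
theorem vaddInvariantMeasure_restrict_of_preimage_eq {G α : Type*} [AddGroup G] [AddAction G α]
    [MeasurableSpace α] [MeasurableConstVAdd G α] {μ : Measure α} [VAddInvariantMeasure G α μ]
    {s : Set α} (hs : MeasurableSet s) (hinv : ∀ g : G, (fun x ↦ g +ᵥ x) ⁻¹' s = s) :
    VAddInvariantMeasure G α (μ.restrict s) := by
  refine ⟨fun g t ht ↦ ?_⟩
  have hgt : MeasurableSet ((fun x ↦ g +ᵥ x) ⁻¹' t) := measurable_const_vadd g ht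
  rw [Measure.restrict_apply hgt, Measure.restrict_apply ht]
  conv_lhs => rw [← hinv g, ← preimage_inter]
  exact VAddInvariantMeasure.measure_preimage_vadd g (ht.inter hs)

variable {V' : Type*} [NormedAddCommGroup V'] [NormedSpace ℝ V']

/-- **Pull-back of a smooth form along a continuous linear map**: `(L^*φ)(x) = φ(Lx) ∘ ⋀L` is smooth.
[cite: Federer1969, 4.1.6] -/
theorem contDiff_compContinuousLinearMap_comp {k : ℕ} {φ : V' → V' [⋀^Fin k]→L[ℝ] ℝ} (hφ : ContDiff ℝ ∞ φ)
    (L : V →L[ℝ] V') : ContDiff ℝ ∞ fun x ↦ (φ (L x)).compContinuousLinearMap L := by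
  have h1 : ContDiff ℝ ∞ fun x ↦ φ (L x) := hφ.comp L.contDiff
  exact (ContinuousAlternatingMap.compContinuousLinearMapCLM (ι := Fin k) (F := ℝ) L).contDiff.comp h1

/-- **`d(L^*φ) = L^*(dφ)`** for a continuous linear map `L` (Mathlib's `extDeriv_pullback`).
[cite: Federer1969, 4.1.6] -/
theorem extDeriv_compContinuousLinearMap_comp {k : ℕ} {φ : V' → V' [⋀^Fin k]→L[ℝ] ℝ} (hφ : ContDiff ℝ ∞ φ)
    (L : V →L[ℝ] V') (x : V) :
    extDeriv (fun y ↦ (φ (L y)).compContinuousLinearMap L) x = (extDeriv φ (L x)).compContinuousLinearMap L := by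
  have h := extDeriv_pullback (f := ⇑L) (x := x) (r := ∞)
    ((hφ.differentiable (by simp)).differentiableAt (x := L x)) L.contDiff.contDiffAt
    (by rw [minSmoothness_of_isRCLikeNormedField]; exact WithTop.coe_le_coe.2 le_top)
  simp only [ContinuousLinearMap.fderiv] at h
  exact h

/-- The pulled-back form is supported in the preimage of the support. [cite: Federer1969, 4.1.6] -/
theorem tsupport_compContinuousLinearMap_comp_subset {k : ℕ} (φ : V' → V' [⋀^Fin k]→L[ℝ] ℝ)
    (L : V →L[ℝ] V') : tsupport (fun y ↦ (φ (L y)).compContinuousLinearMap L) ⊆ L ⁻¹' tsupport φ := by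
  refine closure_minimal (fun x hx ↦ ?_) ((isClosed_tsupport φ).preimage L.continuous)
  rw [mem_preimage]
  refine subset_tsupport _ (mem_support.2 fun h0 ↦ hx ?_)
  change (φ (L x)).compContinuousLinearMap L = 0
  rw [h0]
  ext v
  rfl

end Aux

/-! ### The push-forward `p_w# ([T] ⌞ B)` and its closedness over a ball -/

namespace HolomorphicChain

section Pushforward

variable {ι : Type*} [Fintype ι] [DecidableEq ι] {E : Type u} [NormedAddCommGroup E] [InnerProductSpace ℂ E]
  [FiniteDimensional ℂ E] [MeasurableSpace E] [BorelSpace E] (Φ : (ι → ℝ) ≃L[ℝ] E) {q : ℕ}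

/-- `[T]⌞B (φ)` for a `(q+1)`-chain, read in degree `2q+1+1`. [cite: Federer1969, 4.1.7] -/
theorem windowCurrent_apply_succ (T : HolomorphicChain 𝓘(ℂ, E) (⊤ : Opens E) (q + 1)) {B : Set E}
    (hB : MeasurableSet B) (φ : TestForm (⊤ : Opens E) (2 * q + 1 + 1)) :
    (T.windowCurrent B : Current (⊤ : Opens E) (2 * q + 1 + 1)) φ =
      ∫ x in B, (T.density x : ℝ) * φ x (T.orientationFrame x)
        ∂((μHE[2 * (q + 1)] : Measure E).restrict T.carrier) :=
  T.windowCurrent_apply hB φ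

/-- **The push-forward `p_w# ([T] ⌞ B)`** of the part of the chain in the projection window
`B = projWindow Φ w R'` along the coordinate projection `p_w : E → ℝ^{2q+2}` (cutoff `χ`), a
`(2q+2)`-current on `ℝ^{2q+2}` (Federer 4.1.7). [cite: Federer1969, 4.1.7] -/
def projCurrent (T : HolomorphicChain 𝓘(ℂ, E) (⊤ : Opens E) (q + 1)) (w : Fin (2 * (q + 1)) → ι) (R' : ℝ)
    (χ : 𝓓((⊤ : Opens E), ℝ)) :
    Current (⊤ : Opens (EuclideanSpace ℝ (Fin (2 * (q + 1))))) (2 * q + 1 + 1) :=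
  (T.windowCurrent (ComplexTorus.projWindow Φ w R') : Current (⊤ : Opens E) (2 * q + 1 + 1)).pushforward ⊤ χ
    (ComplexTorus.contDiff_wordProj Φ w)

/-- `p_w# ([T] ⌞ B)` is a rectifiable current (Federer 4.1.30: push-forwards of rectifiable currents
with compact support are rectifiable), for a cutoff `χ = 1` near `closure B`. [cite: Federer1969, 4.1.30] -/
theorem isRectifiable_projCurrent (T : HolomorphicChain 𝓘(ℂ, E) (⊤ : Opens E) (q + 1))
    (w : Fin (2 * (q + 1)) → ι) (R' : ℝ) (χ : 𝓓((⊤ : Opens E), ℝ))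
    (hχ : ∀ x ∈ closure (ComplexTorus.projWindow Φ w R'), χ x = 1) :
    (T.projCurrent Φ w R' χ).IsRectifiable := by
  letI : InnerProductSpace ℝ E := InnerProductSpace.complexToReal
  have h := T.isRectifiable_windowCurrent (ComplexTorus.measurableSet_projWindow Φ w R')
    (ComplexTorus.isCompact_closure_projWindow Φ w R')
  exact h.pushforward_top χ (fun x hx ↦ hχ x (T.support_windowCurrent_subset _ hx))
    (ComplexTorus.contDiff_wordProj Φ w)

/-- `p_w# ([T] ⌞ B)` has finite mass (is representable). [cite: Federer1969, 4.1.7] -/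
theorem isRepresentable_projCurrent (T : HolomorphicChain 𝓘(ℂ, E) (⊤ : Opens E) (q + 1))
    (w : Fin (2 * (q + 1)) → ι) (R' : ℝ) (χ : 𝓓((⊤ : Opens E), ℝ)) :
    (T.projCurrent Φ w R' χ).IsRepresentable :=
  (T.isRepresentable_windowCurrent (ComplexTorus.measurableSet_projWindow Φ w R')).pushforward χ _

/-- **`∂(p_w# ([T] ⌞ B)) = 0` over the ball `B(0, R)`, `R ≤ R'`**, for a chain with `Λ`-periodic
carrier and density: `∂S(φ) = [T]⌞B (d(p_w^*φ)) = ∫_{slab} θ_T ⟨d(p_w^*φ), ξ_T⟩ d𝓗 = 0` by Stokes over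
the slab (`setIntegral_slab_density_mul_extDeriv_apply_eq_zero`), the form `p_w^*φ` being periodic under
the complementary lattice `Λ_{ι∖w}` and supported over `p_w⁻¹ B(0,R)`.
[cite: VoisinHodgeI2002, §11.1.2 Thm. 11.21] -/
theorem boundary_projCurrent_apply_eq_zero (T : HolomorphicChain 𝓘(ℂ, E) (⊤ : Opens E) (q + 1))
    (hcar : ∀ (m : ι → ℤ) (x : E), ComplexTorus.latticeVec Φ m + x ∈ T.carrier ↔ x ∈ T.carrier)
    (hdens : ∀ (m : ι → ℤ), ∀ x ∈ T.carrier, T.density (ComplexTorus.latticeVec Φ m + x) = T.density x)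
    (w : Fin (2 * (q + 1)) → ι) {R R' : ℝ} (hRR' : R ≤ R') (χ : 𝓓((⊤ : Opens E), ℝ))
    (hχ : ∀ x ∈ ComplexTorus.projWindow Φ w R', χ x = 1)
    (φ : TestForm (⊤ : Opens (EuclideanSpace ℝ (Fin (2 * (q + 1))))) (2 * q + 1))
    (hφ : tsupport ⇑φ ⊆ ball 0 R) :
    (T.projCurrent Φ w R' χ).boundary φ = 0 := by
  set p := ComplexTorus.wordProj Φ w with hp
  set K := ComplexTorus.wordCompl w with hK
  set B := ComplexTorus.projWindow Φ w R' with hB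
  have hBm : MeasurableSet B := ComplexTorus.measurableSet_projWindow Φ w R'
  set μ : Measure E := (μHE[2 * (q + 1)] : Measure E).restrict T.carrier with hμ
  set Ψ : E → E [⋀^Fin (2 * q + 1)]→L[ℝ] ℝ := fun x ↦ (φ (p x)).compContinuousLinearMap p with hΨ
  have hφs : ContDiff ℝ ∞ ⇑φ := φ.contDiff
  have hΨs : ContDiff ℝ ∞ Ψ := contDiff_compContinuousLinearMap_comp hφs p
  have hdΨ : ∀ x, extDeriv Ψ x = (extDeriv ⇑φ (p x)).compContinuousLinearMap p := fun x ↦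
    extDeriv_compContinuousLinearMap_comp hφs p x
  have hΨper : ∀ (m : K → ℤ) (x : E), Ψ (ComplexTorus.latticeVecOn Φ K m + x) = Ψ x := fun m x ↦ by
    simp only [hΨ, hp, ComplexTorus.wordProj_latticeVecOn_add Φ K w (ComplexTorus.apply_notMem_wordCompl w) m x]
  have hΨ0 : ∀ x, Ψ x ≠ 0 → φ (p x) ≠ 0 := fun x hx h0 ↦ hx (by
    simp only [hΨ, h0]; ext v; rfl)
  have hΨR : ∀ x, Ψ x ≠ 0 → ∀ i, i ∉ K → |Φ.symm x i| ≤ R := by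
    intro x hx i hi
    have hpx : p x ∈ ball (0 : EuclideanSpace ℝ (Fin (2 * (q + 1)))) R :=
      hφ (subset_tsupport _ (mem_support.2 (hΨ0 x hx)))
    rw [mem_ball, dist_zero_right] at hpx
    exact (ComplexTorus.abs_symm_apply_le_norm_wordProj_of_notMem Φ w x hi).trans hpx.le
  -- the boundary as an integral over `B`, then over the slab
  rw [Current.boundary_apply, projCurrent, Current.pushforward_apply, T.windowCurrent_apply_succ hBm]
  set F : E → ℝ := fun x ↦ (T.density x : ℝ) * extDeriv Ψ x (T.orientationFrame x) with hF
  have h1 : ∫ x in B, (T.density x : ℝ) *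
      (TestForm.pullback χ (ComplexTorus.contDiff_wordProj Φ w) (TestForm.extDerivCLM φ)) x
        (T.orientationFrame x) ∂μ = ∫ x in B, F x ∂μ := by
    refine setIntegral_congr_fun hBm fun x hx ↦ ?_
    simp only [hF]
    rw [TestForm.pullback_apply, hχ x hx, one_smul, ContinuousLinearMap.fderiv,
      congrFun (TestForm.extDerivCLM_apply φ) (p x), ← hdΨ x]
  have h2 : ∫ x in B, F x ∂μ = ∫ x in ComplexTorus.slab Φ K 0, F x ∂μ := by
    symm
    refine setIntegral_eq_of_subset_of_forall_sdiff_eq_zero (ComplexTorus.measurableSet_slab Φ K 0)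
      inter_subset_left fun x hx ↦ ?_
    have hpx : p x ∉ ball (0 : EuclideanSpace ℝ (Fin (2 * (q + 1)))) R' := fun h ↦ hx.2 ⟨hx.1, h⟩
    have hx' : x ∉ tsupport Ψ := fun h ↦
      hpx (ball_subset_ball hRR' (hφ (tsupport_compContinuousLinearMap_comp_subset _ p h)))
    simp only [hF, extDeriv_eq_zero_of_notMem_tsupport' hx', ContinuousAlternatingMap.coe_zero, Pi.zero_apply,
      mul_zero]
  rw [h1, h2]
  exact T.setIntegral_slab_density_mul_extDeriv_apply_eq_zero Φ K hcar hdens hΨs hΨper hΨR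

/-- **`p_w# ([T]⌞B) (h dy) = ∫_{Φ[0,1)^ι} θ_T dx_w(ξ_T) d𝓗`**: tested on the product bump times the volume
covector, the push-forward computes the period of `dx_w` over ONE period box. The pulled-back integrand is
`θ_T h(p_w x) dx_w(ξ_T)` on the window, `h ∘ p_w` is the fundamental weight of `Λ_w`, and UNFOLDING the
slab of `ι ∖ w` along `Λ_w` (`integral_eq_sum_setIntegral_slab`, `Σ_m h(p_w(x + Φm)) = 1`) leaves the
integral over `slab_{ι∖w} ∩ slab_w = Φ[0,1)^ι`. [cite: Lange2023AbelianVarietiesComplex, §1.1.4 Prop. 1.1.20] -/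
theorem projCurrent_apply_bumpVol (T : HolomorphicChain 𝓘(ℂ, E) (⊤ : Opens E) (q + 1))
    (hcar : ∀ (m : ι → ℤ) (x : E), ComplexTorus.latticeVec Φ m + x ∈ T.carrier ↔ x ∈ T.carrier)
    (hdens : ∀ (m : ι → ℤ), ∀ x ∈ T.carrier, T.density (ComplexTorus.latticeVec Φ m + x) = T.density x)
    (w : Fin (2 * (q + 1)) → ι) (hw : Injective w) {R' : ℝ} (hR' : 2 * (2 * (q + 1) : ℕ) + 1 ≤ R')
    (χ : 𝓓((⊤ : Opens E), ℝ)) (hχ : ∀ x ∈ ComplexTorus.projWindow Φ w R', χ x = 1) :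
    T.projCurrent Φ w R' χ
        (smulCovectorCLM (frameCovector ⇑(EuclideanSpace.basisFun (Fin (2 * (q + 1))) ℝ))
          (bumpProdTest (2 * (q + 1)))) =
      ∫ x in ComplexTorus.periodBox Φ 0,
        (T.density x : ℝ) * ComplexTorus.realLatMonomial Φ w (T.orientationFrame x)
          ∂((μHE[2 * (q + 1)] : Measure E).restrict T.carrier) := by
  letI : InnerProductSpace ℝ E := InnerProductSpace.complexToReal
  set p := ComplexTorus.wordProj Φ w with hp
  set K := ComplexTorus.wordCompl w with hK
  set I : Finset ι := Finset.univ.image w with hI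
  set B := ComplexTorus.projWindow Φ w R' with hB
  have hBm : MeasurableSet B := ComplexTorus.measurableSet_projWindow Φ w R'
  set μ : Measure E := (μHE[2 * (q + 1)] : Measure E).restrict T.carrier with hμ
  set dxR := ComplexTorus.realLatMonomial Φ w with hdxR
  set G₀ : E → ℝ := fun x ↦ (T.density x : ℝ) * dxR (T.orientationFrame x) with hG₀
  set G : E → ℝ := fun x ↦ ComplexTorus.weight Φ I x * G₀ x with hG
  have hcarm : MeasurableSet T.carrier := T.isRectifiableData.1
  have hDm : MeasurableSet (ComplexTorus.slab Φ K (0 : ι → ℝ)) := ComplexTorus.measurableSet_slab Φ K 0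
  have hDIm : MeasurableSet (ComplexTorus.slab Φ I (0 : ι → ℝ)) := ComplexTorus.measurableSet_slab Φ I 0
  rw [projCurrent, Current.pushforward_apply, T.windowCurrent_apply_succ hBm]
  -- Step 1: the pulled-back integrand on `B` is `G = w_I · θ · dx_w(ξ)`
  have h1 : ∫ x in B, (T.density x : ℝ) *
      (TestForm.pullback χ (ComplexTorus.contDiff_wordProj Φ w)
        (smulCovectorCLM (frameCovector ⇑(EuclideanSpace.basisFun (Fin (2 * (q + 1))) ℝ))
          (bumpProdTest (2 * (q + 1))))) x (T.orientationFrame x) ∂μ = ∫ x in B, G x ∂μ := by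
    refine setIntegral_congr_fun hBm fun x hx ↦ ?_
    rw [TestForm.pullback_apply, hχ x hx, one_smul, ContinuousLinearMap.fderiv, smulCovectorCLM_apply,
      bumpProdTest_apply, ContinuousAlternatingMap.compContinuousLinearMap_apply,
      ContinuousAlternatingMap.smul_apply, smul_eq_mul, ← hp,
      ← ComplexTorus.weight_image_eq_bumpProd_wordProj Φ w hw x,
      show frameCovector _ (⇑p ∘ T.orientationFrame x) = dxR (T.orientationFrame x) from rfl]
    simp only [hG, hG₀]
    ring
  -- Step 2: from `B` to the slab of `K` (the weight vanishes off `p⁻¹ B(0, R')`)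
  have h2 : ∫ x in B, G x ∂μ = ∫ x in ComplexTorus.slab Φ K 0, G x ∂μ := by
    symm
    refine setIntegral_eq_of_subset_of_forall_sdiff_eq_zero hDm inter_subset_left fun x hx ↦ ?_
    have hw0 : ComplexTorus.weight Φ I x = 0 := by
      by_contra h
      refine hx.2 ⟨hx.1, ?_⟩
      rw [ComplexTorus.weight_image_eq_bumpProd_wordProj Φ w hw x] at h
      exact ball_subset_ball hR' (support_bumpProd_subset_ball (2 * (q + 1)) (mem_support.2 h))
    simp only [hG, hw0, zero_mul]
  -- Step 3: unfolding along `Λ_I` for the `Λ_I`-invariant measure `μ ⌞ slab_K`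
  set μK : Measure E := μ.restrict (ComplexTorus.slab Φ K 0) with hμK
  haveI : VAddInvariantMeasure (ComplexTorus.coordSubLattice Φ I) E μ :=
    T.vaddInvariantMeasure_coordSubLattice Φ I hcar
  haveI : VAddInvariantMeasure (ComplexTorus.coordSubLattice Φ I) E μK :=
    vaddInvariantMeasure_restrict_of_preimage_eq hDm fun g ↦ by
      obtain ⟨m, hm⟩ := (ComplexTorus.mem_coordSubLattice_iff Φ I).1 g.2
      ext x
      rw [mem_preimage, ComplexTorus.coordSubLattice_vadd, ← hm]
      exact ComplexTorus.latticeVecOn_image_add_mem_slab_wordCompl_iff Φ w m x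
  -- integrability of `G` on the slab of `K`
  have hQc : IsCompact (coordBox Φ K 2) := isCompact_coordBox Φ K 2
  have hcont : Continuous fun x ↦ ComplexTorus.weight Φ I x • dxR :=
    (ComplexTorus.contDiff_weight Φ I (n := 0)).continuous.smul continuous_const
  have hGQ : IntegrableOn G (coordBox Φ K 2) μ := by
    have h := T.integrableOn_density_mul_apply_of_isCompact hQc hcont
    refine h.congr_fun (fun x _ ↦ ?_) hQc.isClosed.measurableSet
    simp only [hG, hG₀, ContinuousAlternatingMap.smul_apply, smul_eq_mul]
    ring
  have hG_offQ : ∀ x ∈ ComplexTorus.slab Φ K 0 \ coordBox Φ K 2, G x = 0 := by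
    rintro x ⟨hxD, hxQ⟩
    simp only [coordBox, mem_setOf_eq, not_and_or, not_forall, not_le, exists_prop] at hxQ
    rcases hxQ with ⟨k, hk, hxk⟩ | ⟨i, hi, hxi⟩
    · have h := hxD k hk
      simp only [Pi.zero_apply, zero_add, mem_Ico] at h
      exact (hxk ⟨by linarith [h.1], by linarith [h.2]⟩).elim
    · obtain ⟨j, rfl⟩ := ComplexTorus.exists_apply_eq_of_notMem_wordCompl w hi
      have hw0 : ComplexTorus.weight Φ I x = 0 := by
        by_contra h
        have hm := ComplexTorus.mem_Ioo_of_weight_ne_zero Φ I h (Finset.mem_image_of_mem w (Finset.mem_univ j))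
        have : |Φ.symm x (w j)| < 2 := abs_lt.2 ⟨by linarith [hm.1], hm.2⟩
        linarith
      simp only [hG, hw0, zero_mul]
  have hGi : Integrable G μK := hGQ.of_forall_sdiff_eq_zero hDm hG_offQ
  have hxI : ∀ x ∈ ComplexTorus.slab Φ I 0, ∀ k ∈ I, Φ.symm x k ∈ Ioo (-1 : ℝ) 2 := fun x hx k hk ↦
    ComplexTorus.mem_Ioo_of_mem_slab Φ I hx hk
  have hGwin : ∀ (m : I → ℤ), ∀ x ∈ ComplexTorus.slab Φ I 0,
      G (ComplexTorus.latticeVecOn Φ I m + x) ≠ 0 → m ∈ ComplexTorus.windowOn I := fun m x hx h ↦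
    ComplexTorus.mem_windowOn_of_weight_ne_zero Φ I (hxI x hx) (left_ne_zero_of_mul h)
  have h3 : ∫ x, G x ∂μK = ∑ m ∈ ComplexTorus.windowOn I,
      ∫ x in ComplexTorus.slab Φ I 0, G (ComplexTorus.latticeVecOn Φ I m + x) ∂μK :=
    ComplexTorus.integral_eq_sum_setIntegral_slab Φ I hGi (ComplexTorus.windowOn I) hGwin
  -- periodicity of `G₀` on the carrier
  have hcar' : ∀ m : I → ℤ, (fun x ↦ ComplexTorus.latticeVecOn Φ I m + x) ⁻¹' T.carrier = T.carrier :=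
    fun m ↦ Set.ext fun x ↦ hcar _ x
  have hξ : ∀ (m : I → ℤ) (x : E), T.orientationFrame (ComplexTorus.latticeVecOn Φ I m + x) =
      T.orientationFrame x := fun m x ↦ T.orientationFrame_const_add (hcar' m) x
  have hG₀per : ∀ (m : I → ℤ), ∀ x ∈ T.carrier, G₀ (ComplexTorus.latticeVecOn Φ I m + x) = G₀ x := by
    intro m x hx
    simp only [hG₀]
    rw [hξ m x, ComplexTorus.latticeVecOn_apply, hdens _ x hx]
  have haeI : ∀ᵐ x ∂(μK.restrict (ComplexTorus.slab Φ I 0)), x ∈ T.carrier :=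
    ae_restrict_of_ae (ae_restrict_of_ae (ae_restrict_mem hcarm))
  have hterm : ∀ m ∈ ComplexTorus.windowOn I,
      ∫ x in ComplexTorus.slab Φ I 0, G (ComplexTorus.latticeVecOn Φ I m + x) ∂μK =
        ∫ x in ComplexTorus.slab Φ I 0, ComplexTorus.weight Φ I (ComplexTorus.latticeVecOn Φ I m + x) * G₀ x ∂μK := by
    intro m _
    refine integral_congr_ae ?_
    filter_upwards [haeI] with x hx
    simp only [hG, hG₀per m x hx]
  -- `(μ ⌞ slab_K) ⌞ slab_I = μ ⌞ Φ[0,1)^ι`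
  have hKI : μK.restrict (ComplexTorus.slab Φ I 0) = μ.restrict (ComplexTorus.periodBox Φ 0) := by
    rw [hμK, Measure.restrict_restrict hDIm, ComplexTorus.slab_image_inter_slab_wordCompl Φ w]
  have hG₀i : Integrable G₀ (μK.restrict (ComplexTorus.slab Φ I 0)) := by
    have h : IntegrableOn G₀ (ComplexTorus.periodBox Φ 0) μ :=
      (T.integrableOn_density_mul_apply_of_isCompact (ComplexTorus.isCompact_closedPeriodBox Φ 0)
        (continuous_const : Continuous fun _ : E ↦ dxR)).mono_set
        (ComplexTorus.periodBox_subset_closedPeriodBox Φ 0)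
    rw [hKI]
    exact h
  have hint : ∀ m ∈ ComplexTorus.windowOn I,
      Integrable (fun x ↦ ComplexTorus.weight Φ I (ComplexTorus.latticeVecOn Φ I m + x) * G₀ x)
        (μK.restrict (ComplexTorus.slab Φ I 0)) := fun m _ ↦
    hG₀i.bdd_mul ((ComplexTorus.contDiff_weight Φ I (n := 0)).continuous.comp
      (continuous_const.add continuous_id)).aestronglyMeasurable
      (ae_of_all _ fun x ↦ by rw [Real.norm_eq_abs]; exact ComplexTorus.abs_weight_le_one Φ I _)
  have h4 : ∑ m ∈ ComplexTorus.windowOn I,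
      ∫ x in ComplexTorus.slab Φ I 0, G (ComplexTorus.latticeVecOn Φ I m + x) ∂μK =
        ∫ x in ComplexTorus.slab Φ I 0, G₀ x ∂μK := by
    rw [Finset.sum_congr rfl hterm, ← integral_finsetSum _ hint]
    refine setIntegral_congr_fun hDIm fun x hx ↦ ?_
    rw [← Finset.sum_mul, ComplexTorus.sum_windowOn_weight Φ I (hxI x hx), one_mul]
  -- assemble
  rw [h1, h2]
  change ∫ x, G x ∂μK = _
  rw [h3, h4, hKI]

/-! ### Constancy: the period of `dx_w` over one box is an integer -/

/-- **`∫_{Φ[0,1)^ι} θ_T dx_w(ξ_T) d𝓗 ∈ ℤ` for an injective word `w`** — the heart of the integrality.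
By Federer's constancy theorem (`Current.IsRectifiable.exists_int_restrictSet_eq_face`, with the
integrality of the density of rectifiable currents) the closed rectifiable current `p_w# ([T]⌞B)` of
finite mass is an INTEGER multiple `a [B(0,R)]` of the oriented ball; testing on `h dy` with `∫ h = 1`
gives `∫_{box} θ_T dx_w(ξ_T) = a`. [cite: Federer1969, 4.1.31 (2) and 4.1.28] -/
theorem exists_int_setIntegral_periodBox_realLatMonomial (T : HolomorphicChain 𝓘(ℂ, E) (⊤ : Opens E) (q + 1))
    (hcar : ∀ (m : ι → ℤ) (x : E), ComplexTorus.latticeVec Φ m + x ∈ T.carrier ↔ x ∈ T.carrier)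
    (hdens : ∀ (m : ι → ℤ), ∀ x ∈ T.carrier, T.density (ComplexTorus.latticeVec Φ m + x) = T.density x)
    (w : Fin (2 * (q + 1)) → ι) (hw : Injective w) :
    ∃ a : ℤ, ∫ x in ComplexTorus.periodBox Φ 0,
        (T.density x : ℝ) * ComplexTorus.realLatMonomial Φ w (T.orientationFrame x)
          ∂((μHE[2 * (q + 1)] : Measure E).restrict T.carrier) = a := by
  letI : InnerProductSpace ℝ E := InnerProductSpace.complexToReal
  -- radii, window, cutoff
  set R : ℝ := 2 * ((2 * (q + 1) : ℕ) : ℝ) + 1 with hR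
  set R' : ℝ := R + 1 with hR'
  have hRR' : R ≤ R' := by rw [hR']; linarith
  set B := ComplexTorus.projWindow Φ w R' with hB
  have hBm : MeasurableSet B := ComplexTorus.measurableSet_projWindow Φ w R'
  obtain ⟨χ, Vχ, -, hBV, hχ1, -⟩ := exists_testFunction_eq_one_nhds (Ω := (⊤ : Opens E))
    (ComplexTorus.isCompact_closure_projWindow Φ w R') (subset_univ _)
  have hχcl : ∀ x ∈ closure B, χ x = 1 := fun x hx ↦ hχ1 x (hBV hx)
  have hχB : ∀ x ∈ B, χ x = 1 := fun x hx ↦ hχcl x (subset_closure hx)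
  -- the push-forward, rectifiable of finite mass
  set S := T.projCurrent Φ w R' χ with hS
  have hSrect : S.IsRectifiable := T.isRectifiable_projCurrent Φ w R' χ hχcl
  have hSr : S.IsRepresentable := T.isRepresentable_projCurrent Φ w R' χ
  -- the data of the constancy theorem on `ℝ^{2q+2}`: the whole space as the plane, the ball `B(0,R)`
  set e := EuclideanSpace.basisFun (Fin (2 * (q + 1))) ℝ with he
  have hplane : {x : EuclideanSpace ℝ (Fin (2 * (q + 1))) |
      x - 0 ∈ (⊤ : Submodule ℝ (EuclideanSpace ℝ (Fin (2 * (q + 1)))))} = univ := by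
    ext x; simp
  have hP₀ : Module.finrank ℝ (⊤ : Submodule ℝ (EuclideanSpace ℝ (Fin (2 * (q + 1))))) = 2 * q + 1 + 1 := by
    rw [finrank_top, finrank_euclideanSpace_fin]; ring
  have hvol : (μHE[2 * q + 1 + 1] : Measure (EuclideanSpace ℝ (Fin (2 * (q + 1))))) = volume :=
    EuclideanSpace.euclideanHausdorffMeasure_eq_volume (2 * (q + 1))
  have hvol' : (μHE[2 * (q + 1)] : Measure (EuclideanSpace ℝ (Fin (2 * (q + 1))))) = volume :=
    EuclideanSpace.euclideanHausdorffMeasure_eq_volume (2 * (q + 1))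
  have hUo : IsOpen (ball (0 : EuclideanSpace ℝ (Fin (2 * (q + 1)))) R) := isOpen_ball
  have hUc : IsPreconnected (ball (0 : EuclideanSpace ℝ (Fin (2 * (q + 1)))) R ∩
      {x | x - 0 ∈ (⊤ : Submodule ℝ (EuclideanSpace ℝ (Fin (2 * (q + 1)))))}) := by
    rw [hplane, inter_univ]
    exact (convex_ball _ _).isPreconnected
  have hfin : (μHE[2 * q + 1 + 1] : Measure (EuclideanSpace ℝ (Fin (2 * (q + 1)))))
      (ball 0 R ∩ {x | x - 0 ∈ (⊤ : Submodule ℝ (EuclideanSpace ℝ (Fin (2 * (q + 1)))))}) ≠ ⊤ := by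
    rw [hplane, inter_univ, hvol]
    exact measure_ball_lt_top.ne
  have hsupp : S.support ∩ ball 0 R ⊆
      {x | x - 0 ∈ (⊤ : Submodule ℝ (EuclideanSpace ℝ (Fin (2 * (q + 1)))))} := by
    rw [hplane]; exact subset_univ _
  obtain ⟨a, ha⟩ := hSrect.exists_int_restrictSet_eq_face hSr ⊤ 0 hP₀ (e := ⇑e) e.orthonormal
    (fun _ ↦ Submodule.mem_top) hUo hUc hfin hsupp
    (fun φ hφ ↦ T.boundary_projCurrent_apply_eq_zero Φ hcar hdens w hRR' χ hχB φ hφ)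
  refine ⟨a, ?_⟩
  -- test on `h dy`
  set τ : TestForm (⊤ : Opens (EuclideanSpace ℝ (Fin (2 * (q + 1))))) (2 * q + 1 + 1) :=
    smulCovectorCLM (frameCovector ⇑e) (bumpProdTest (2 * (q + 1))) with hτ
  have hτe : ∀ y, τ y ⇑e = bumpProd (2 * (q + 1)) y := fun y ↦ by
    rw [hτ, smulCovectorCLM_apply, ContinuousAlternatingMap.smul_apply, frameCovector_self e.orthonormal,
      smul_eq_mul, mul_one, bumpProdTest_apply]
  have hτU : Function.support ⇑τ ⊆ ball 0 R := by
    intro y hy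
    refine support_bumpProd_subset_ball (2 * (q + 1)) (mem_support.2 fun h0 ↦ hy ?_)
    change bumpProdTest (2 * (q + 1)) y • frameCovector ⇑e = 0
    rw [bumpProdTest_apply, h0, zero_smul]
  have hL : hSr.restrictSet (ball 0 R) hUo.measurableSet τ = S τ :=
    hSr.restrictSet_apply_of_support_subset hUo.measurableSet hτU
  have hRval : (currentOfIntegration (ball 0 R ∩ {x | x - 0 ∈ (⊤ : Submodule ℝ (EuclideanSpace ℝ (Fin (2 * (q + 1)))))})
      (fun _ ↦ a) (fun _ ↦ ⇑e) : Current (⊤ : Opens (EuclideanSpace ℝ (Fin (2 * (q + 1))))) (2 * q + 1 + 1)) τ = a := by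
    rw [hplane, inter_univ]
    haveI : IsFiniteMeasure ((μHE[2 * q + 1 + 1] : Measure (EuclideanSpace ℝ (Fin (2 * (q + 1))))).restrict
        (ball 0 R)) := ⟨by rw [Measure.restrict_apply_univ, hvol]; exact measure_ball_lt_top⟩
    have hloc : LocallyIntegrableOn (fun _ : EuclideanSpace ℝ (Fin (2 * (q + 1))) ↦ ((a : ℤ) : ℝ) • frameVector ⇑e)
        ((⊤ : Opens (EuclideanSpace ℝ (Fin (2 * (q + 1))))) : Set _)
        ((μHE[2 * q + 1 + 1] : Measure (EuclideanSpace ℝ (Fin (2 * (q + 1))))).restrict (ball 0 R)) :=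
      ((integrable_const _).locallyIntegrable).locallyIntegrableOn _
    rw [currentOfIntegration_apply hloc]
    simp_rw [hτe]
    rw [integral_const_mul, setIntegral_eq_integral_of_forall_compl_eq_zero fun y hy ↦
      notMem_support.1 fun h ↦ hy (support_bumpProd_subset_ball _ h)]
    rw [hvol', integral_bumpProd, mul_one]
  have h := congrArg (fun C : Current (⊤ : Opens (EuclideanSpace ℝ (Fin (2 * (q + 1))))) (2 * q + 1 + 1) ↦ C τ) ha
  simp only at h
  rw [hL, hRval, hS, T.projCurrent_apply_bumpVol Φ hcar hdens w hw (by rw [hR']; linarith) χ hχB] at h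
  exact h

end Pushforward

/-! ### Integrality of the periods -/

section Periods

variable {ι : Type*} [Fintype ι] [DecidableEq ι] {E : Type u} [NormedAddCommGroup E] [InnerProductSpace ℂ E]
  [FiniteDimensional ℂ E] [MeasurableSpace E] [BorelSpace E] (Φ : (ι → ℝ) ≃L[ℝ] E) {q : ℕ}

/-- **`∫_Z dx_w ∈ ℤ`**: the period of a lattice monomial over a holomorphic `(q+1)`-chain with
`Λ`-periodic carrier and density is an integer (zero for a word with a repeated letter).
[cite: VoisinHodgeI2002, §11.1.2 Cor. 11.15 and Thm. 11.21] -/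
theorem exists_int_torusPeriod_latMonomial_of_periodic (T : HolomorphicChain 𝓘(ℂ, E) (⊤ : Opens E) (q + 1))
    (hcar : ∀ (m : ι → ℤ) (x : E), ComplexTorus.latticeVec Φ m + x ∈ T.carrier ↔ x ∈ T.carrier)
    (hdens : ∀ (m : ι → ℤ), ∀ x ∈ T.carrier, T.density (ComplexTorus.latticeVec Φ m + x) = T.density x)
    (w : Fin (2 * (q + 1)) → ι) :
    ∃ z : ℤ, T.torusPeriod Φ (ComplexTorus.latMonomial Φ (2 * (q + 1)) w) = z := by
  by_cases hw : Injective w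
  · obtain ⟨a, ha⟩ := T.exists_int_setIntegral_periodBox_realLatMonomial Φ hcar hdens w hw
    refine ⟨a, ?_⟩
    rw [ComplexTorus.latMonomial_eq_ofReal_realLatMonomial, T.torusPeriod_ofReal Φ, ha, Complex.ofReal_intCast]
  · exact ⟨0, by rw [ComplexTorus.latMonomial_eq_zero_of_not_injective Φ w hw, map_zero, Int.cast_zero]⟩

/-- **INTEGRALITY OF THE PERIODS.** For a holomorphic `(q+1)`-chain `T` on `E` with `Λ`-periodic carrier
and density (the lift of an analytic cycle `Z` of the torus `X = E/Λ`) and every integral class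
`η ∈ H^{2q+2}(X, ℤ) = integralForms Φ (2q+2)`, the period `∫_Z η = torusPeriod Φ T η` is an INTEGER
(Voisin (2002), §11.1.2: the class of `Z` is integral). [cite: VoisinHodgeI2002, §11.1.2 Cor. 11.15 and Thm. 11.21] -/
theorem exists_int_torusPeriod_eq_of_periodic (T : HolomorphicChain 𝓘(ℂ, E) (⊤ : Opens E) (q + 1))
    (hcar : ∀ (m : ι → ℤ) (x : E), ComplexTorus.latticeVec Φ m + x ∈ T.carrier ↔ x ∈ T.carrier)
    (hdens : ∀ (m : ι → ℤ), ∀ x ∈ T.carrier, T.density (ComplexTorus.latticeVec Φ m + x) = T.density x)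
    {η : E [⋀^Fin (2 * (q + 1))]→L[ℝ] ℂ} (hη : η ∈ ComplexTorus.integralForms Φ (2 * (q + 1))) :
    ∃ z : ℤ, T.torusPeriod Φ η = z := by
  rw [ComplexTorus.integralForms_eq_closure_latMonomial] at hη
  induction hη using AddSubgroup.closure_induction with
  | mem η h =>
    obtain ⟨w, rfl⟩ := h
    exact T.exists_int_torusPeriod_latMonomial_of_periodic Φ hcar hdens w
  | zero => exact ⟨0, by rw [map_zero, Int.cast_zero]⟩
  | add η η' _ _ hη hη' =>
    obtain ⟨a, ha⟩ := hη
    obtain ⟨b, hb⟩ := hη'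
    exact ⟨a + b, by rw [map_add, ha, hb, Int.cast_add]⟩
  | neg η _ hη =>
    obtain ⟨a, ha⟩ := hη
    exact ⟨-a, by rw [map_neg, ha, Int.cast_neg]⟩

/-- **Integrality of the periods of a `Λ`-periodic chain** (`IsLatticePeriodic` form).
[cite: VoisinHodgeI2002, §11.1.2 Cor. 11.15 and Thm. 11.21] -/
theorem IsLatticePeriodic.exists_int_torusPeriod_eq {T : HolomorphicChain 𝓘(ℂ, E) (⊤ : Opens E) (q + 1)}
    (hT : T.IsLatticePeriodic Φ) {η : E [⋀^Fin (2 * (q + 1))]→L[ℝ] ℂ}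
    (hη : η ∈ ComplexTorus.integralForms Φ (2 * (q + 1))) : ∃ z : ℤ, T.torusPeriod Φ η = z :=
  T.exists_int_torusPeriod_eq_of_periodic Φ hT.mem_carrier_iff (fun m x _ ↦ hT.density_add m x) hη

/-- **The class `(∫_Z ·)^♭` of a `Λ`-periodic chain of positive dimension is an integral Hodge class**,
unconditionally (the hypothesis of `poincareDualForm_torusPeriod_mem_integralHodgeClasses` discharged).
[cite: VoisinHodgeI2002, §11.1.3 Prop. 11.20] -/
theorem IsLatticePeriodic.poincareDualForm_torusPeriod_mem_integralHodgeClasses {n : ℕ} (e : Fin n ≃ ι)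
    {p : ℕ} (h : 2 * (q + 1) + 2 * p = n) {T : HolomorphicChain 𝓘(ℂ, E) (⊤ : Opens E) (q + 1)}
    (hT : T.IsLatticePeriodic Φ) :
    ComplexTorus.poincareDualForm Φ e h (T.torusPeriod Φ) ∈ ComplexTorus.integralHodgeClasses Φ p :=
  ComplexTorus.poincareDualForm_torusPeriod_mem_integralHodgeClasses Φ e h T
    fun _ hη ↦ hT.exists_int_torusPeriod_eq Φ hη

end Periods

end HolomorphicChain

/-! ### The class of a closed analytic subset of a complex torus is an integral Hodge class -/

namespace ComplexTorus

variable {ι : Type*} [Fintype ι] {E : Type u} [NormedAddCommGroup E] [InnerProductSpace ℂ E]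
  [FiniteDimensional ℂ E] [MeasurableSpace E] [BorelSpace E] (Φ : (ι → ℝ) ≃L[ℝ] E) {d : ℕ}

/-- **`∫_Z η ∈ ℤ` for every `η ∈ H^{2d+2}(X, ℤ)`**: the current of integration of a closed analytic subset
`Z ⊆ X = E/Λ` of pure dimension `d + 1` has integral periods on the integral classes (Voisin (2002),
§11.1.2: the fundamental class of `Z` is integral; here via Federer's constancy theorem).
[cite: VoisinHodgeI2002, §11.1.2 Cor. 11.15 and Thm. 11.21] -/
theorem exists_int_analyticCyclePeriod_eq {Z : Set (ComplexTorus Φ)} (hZ : HasPureDim 𝓘(ℂ, E) Z (d + 1))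
    {η : E [⋀^Fin (2 * (d + 1))]→L[ℝ] ℂ} (hη : η ∈ integralForms Φ (2 * (d + 1))) :
    ∃ z : ℤ, analyticCyclePeriod Φ hZ η = z := by
  classical
  have hper := translateTop_preimage_liftSet Φ Z
  have hcar := HolomorphicChain.carrier_ofSet_periodic Φ (hasPureDim_liftSet Φ hZ) hper
  exact (analyticChain Φ hZ).exists_int_torusPeriod_eq_of_periodic Φ hcar
    (fun m x hx ↦ by
      change (HolomorphicChain.ofSet _ (hasPureDim_liftSet Φ hZ)).density _ =
        (HolomorphicChain.ofSet _ (hasPureDim_liftSet Φ hZ)).density x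
      rw [HolomorphicChain.density_ofSet_of_mem_carrier _ hx,
        HolomorphicChain.density_ofSet_of_mem_carrier _ ((hcar m x).2 hx)])
    hη

variable [DecidableEq ι] {n : ℕ} (e : Fin n ≃ ι)

/-- **THE CLASS OF A CLOSED ANALYTIC SUBSET OF A COMPLEX TORUS IS AN INTEGRAL HODGE CLASS.** For a
closed analytic `Z ⊆ X = E/Λ` of pure dimension `d + 1` and codimension `p` (`2(d+1) + 2p = rk Λ`), the
class `[Z] = (∫_Z ·)^♭ ∈ H^{2p}(X, ℂ)` lies in `H^{2p}(X, ℤ) ∩ H^{p,p} = integralHodgeClasses Φ p` —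
Voisin (2002), Prop. 11.20 with Thm. 11.21, unconditionally (the integrality hypothesis of
`analyticCycleClass_mem_integralHodgeClasses` discharged by `exists_int_analyticCyclePeriod_eq`).
[cite: VoisinHodgeI2002, §11.1.3 Prop. 11.20] -/
theorem analyticCycleClass_mem_integralHodgeClasses_of_pos {p : ℕ} (h : 2 * (d + 1) + 2 * p = n)
    {Z : Set (ComplexTorus Φ)} (hZ : HasPureDim 𝓘(ℂ, E) Z (d + 1)) :
    analyticCycleClass Φ e h hZ ∈ integralHodgeClasses Φ p :=
  analyticCycleClass_mem_integralHodgeClasses Φ e h hZ fun _ hη ↦ exists_int_analyticCyclePeriod_eq Φ hZ hη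

/-- … and hence a Hodge class (Lange (2023), Lemma 6.2.7: classes of analytic cycles are Hodge classes).
[cite: Lange2023AbelianVarietiesComplex, §6.2.1 Lemma 6.2.7] -/
theorem analyticCycleClass_mem_hodgeClasses_of_pos {p : ℕ} (h : 2 * (d + 1) + 2 * p = n)
    {Z : Set (ComplexTorus Φ)} (hZ : HasPureDim 𝓘(ℂ, E) Z (d + 1)) :
    analyticCycleClass Φ e h hZ ∈ hodgeClasses Φ p :=
  integralHodgeClasses_subset_hodgeClasses Φ p (analyticCycleClass_mem_integralHodgeClasses_of_pos Φ e h hZ)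

end ComplexTorus

end Literature.Geometry.Kaehler
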